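import Mathlib
import HarnessLib

/-!
# PartialFractions — explicit partial fractions with poles of order `≤ 2` (cover-up coefficients), kernel form

HONEST FRAMING: systematic search; no irrationality claim unless certified.

fam-denom (pub-zeta5), service lane DENOMINATOR ARITHMETIC, for fam-catalan's intrinsic 2-adic Catalan-box chain:
the node (L2) `RayPF j := ∀ n ≥ 1, PF n (jn)` of `CatalanTwoAdicRayClosed` is the finite partial-fraction identity
`CatalanTwoAdicPF.PF n J` of the rational function `R_n(T)` (poles of order `1` and `2`).  This file is the GENERIC
algebra behind it, over `ℚ`, with the coefficients in COVER-UP form (no appeal to uniqueness of partial fractions):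

for a finite family of distinct poles `ρ i` (`i ∈ s`) with multiplicities `m i ∈ {1, 2}`, the denominator
`D = ∏ (X − ρ i)^{m i}` (`Dp`), its cofactors `D̂_i = D/(X − ρ i)^{m i}` (`Dhat`) and ANY polynomial `N` with
`deg N < deg D`:

**`pf_eval`** : for every `x` off the poles,
`N(x)/D(x) = Σ_i ( c_i/(x − ρ i)^{m i} + ℓ_i/(x − ρ i) )` with `c_i = N(ρ i)/D̂_i(ρ i)` (`cTop`, the cover-up
coefficient) and `ℓ_i = (N/D̂_i)′(ρ i) = (N′(ρ)D̂(ρ) − N(ρ)D̂′(ρ))/D̂(ρ)²` at a double pole, `0` at a simple one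
(`cLow` / `cNext`).

PROOF (kernel): the polynomial `P = N − Σ_i (c_i D̂_i + ℓ_i (X − ρ i)^{m i − 1} D̂_i)` (`pfRem`) has degree `< deg D`,
vanishes at every pole and has vanishing derivative at every double pole (this is what the two coefficient formulas
say), so every `(X − ρ i)^{m i}` divides it; these are pairwise coprime, hence `D ∣ P`, hence `P = 0`
(`Polynomial.eq_zero_of_dvd_of_natDegree_lt`); evaluate.  Also the logarithmic derivative of a product of linear
factors off its roots, `eval_derivative_prod_linear : (∏ (X − γ k))′(x) = (∏ (X − γ k))(x) · Σ_k (x − γ k)⁻¹`, used by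
`CatalanRayPF` to identify `ℓ_i/c_i` with fam-denom's `logDer`.
No analysis, no limits: finite algebra in `ℚ[X]` only.  Inputs: Mathlib (`Polynomial.rootMultiplicity`,
`Finset.prod_dvd_of_coprime`, `Polynomial.isCoprime_X_sub_C_of_isUnit_sub`).
-/

namespace Summit.KontsevichZagierPeriods.Zeta5Search.Denom.PartialFractions

open Finset Polynomial

variable {ι : Type*} [DecidableEq ι]

section Defs

variable (s : Finset ι) (ρ : ι → ℚ) (m : ι → ℕ)

/-- the denominator `D = ∏_{i ∈ s} (X − ρ i)^{m i}`. -/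
noncomputable def Dp : ℚ[X] := ∏ i ∈ s, (X - C (ρ i)) ^ m i

/-- the cofactor of the pole `i`: `D̂_i = ∏_{i' ≠ i} (X − ρ i')^{m i'}` (`= D/(X − ρ i)^{m i}` for `i ∈ s`). -/
noncomputable def Dhat (i : ι) : ℚ[X] := ∏ i' ∈ s.erase i, (X - C (ρ i')) ^ m i'

/-- the cover-up coefficient `c_i = N(ρ i)/D̂_i(ρ i)`: the coefficient of `(x − ρ i)^{−m i}`. -/
noncomputable def cTop (N : ℚ[X]) (i : ι) : ℚ := N.eval (ρ i) / (Dhat s ρ m i).eval (ρ i)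

/-- the derivative coefficient `(N/D̂_i)′(ρ i) = (N′(ρ)D̂_i(ρ) − N(ρ)D̂_i′(ρ))/D̂_i(ρ)²` (`ρ = ρ i`): at a double pole,
the coefficient of `(x − ρ i)^{−1}`. -/
noncomputable def cNext (N : ℚ[X]) (i : ι) : ℚ :=
  ((derivative N).eval (ρ i) * (Dhat s ρ m i).eval (ρ i)
      - N.eval (ρ i) * (derivative (Dhat s ρ m i)).eval (ρ i)) / (Dhat s ρ m i).eval (ρ i) ^ 2

/-- the coefficient of `(x − ρ i)^{−(m i − 1)}`: `cNext` at a double pole, `0` at a simple pole. -/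
noncomputable def cLow (N : ℚ[X]) (i : ι) : ℚ := if m i = 2 then cNext s ρ m N i else 0

/-- the numerator polynomial of the `i`-th group of partial fractions:
`c_i · D̂_i + ℓ_i · (X − ρ i)^{m i − 1} · D̂_i`. -/
noncomputable def pfTerm (N : ℚ[X]) (i : ι) : ℚ[X] :=
  C (cTop s ρ m N i) * Dhat s ρ m i + C (cLow s ρ m N i) * ((X - C (ρ i)) ^ (m i - 1) * Dhat s ρ m i)

/-- the remainder `P = N − Σ_i pfTerm_i`; the content of the file is `P = 0`. -/
noncomputable def pfRem (N : ℚ[X]) : ℚ[X] := N - ∑ i ∈ s, pfTerm s ρ m N i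

end Defs

variable {s : Finset ι} {ρ : ι → ℚ} {m : ι → ℕ}

/-! ### Evaluation and degree bookkeeping -/

/-- `((X − a)^k)(x) = (x − a)^k`. -/
theorem eval_linPow (a x : ℚ) (k : ℕ) : ((X - C a) ^ k).eval x = (x - a) ^ k := by
  rw [eval_pow, eval_sub, eval_X, eval_C]

/-- `deg (X − a)^k = k`. -/
theorem natDegree_linPow (a : ℚ) (k : ℕ) : ((X - C a) ^ k).natDegree = k := by
  rw [natDegree_pow, natDegree_X_sub_C, mul_one]

/-- `D = (X − ρ i)^{m i} · D̂_i` for a pole `i ∈ s`. -/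
theorem Dp_eq_mul_Dhat {i : ι} (hi : i ∈ s) : Dp s ρ m = (X - C (ρ i)) ^ m i * Dhat s ρ m i :=
  (mul_prod_erase s (fun i' => (X - C (ρ i')) ^ m i') hi).symm

/-- `D̂_i(x) = ∏_{i' ≠ i} (x − ρ i')^{m i'}`. -/
theorem eval_Dhat (i : ι) (x : ℚ) : (Dhat s ρ m i).eval x = ∏ i' ∈ s.erase i, (x - ρ i') ^ m i' := by
  unfold Dhat
  rw [eval_prod]
  exact prod_congr rfl fun i' _ => eval_linPow _ _ _

omit [DecidableEq ι] in
/-- `D(x) = ∏_i (x − ρ i)^{m i}`. -/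
theorem eval_Dp (x : ℚ) : (Dp s ρ m).eval x = ∏ i ∈ s, (x - ρ i) ^ m i := by
  unfold Dp
  rw [eval_prod]
  exact prod_congr rfl fun i' _ => eval_linPow _ _ _

/-- `D̂_i(x) ≠ 0` off the other poles. -/
theorem eval_Dhat_ne {i : ι} {x : ℚ} (hx : ∀ i' ∈ s.erase i, x ≠ ρ i') : (Dhat s ρ m i).eval x ≠ 0 := by
  rw [eval_Dhat]
  exact prod_ne_zero_iff.mpr fun i' hi' => pow_ne_zero _ (sub_ne_zero.mpr (hx i' hi'))

/-- `D̂_i(ρ i) ≠ 0` (the poles are distinct). -/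
theorem eval_Dhat_self_ne (hρ : Function.Injective ρ) (i : ι) : (Dhat s ρ m i).eval (ρ i) ≠ 0 :=
  eval_Dhat_ne fun _ hi' h => ne_of_mem_erase hi' (hρ h).symm

omit [DecidableEq ι] in
/-- `deg D = Σ_i m i`. -/
theorem natDegree_Dp : (Dp s ρ m).natDegree = ∑ i ∈ s, m i := by
  unfold Dp
  rw [natDegree_prod_of_monic _ _ (fun i _ => (monic_X_sub_C (ρ i)).pow (m i))]
  exact sum_congr rfl fun i _ => natDegree_linPow _ _

/-- `deg D̂_i + m i = Σ m` for `i ∈ s`. -/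
theorem natDegree_Dhat_add {i : ι} (hi : i ∈ s) : (Dhat s ρ m i).natDegree + m i = ∑ i' ∈ s, m i' := by
  unfold Dhat
  rw [natDegree_prod_of_monic _ _ (fun i' _ => (monic_X_sub_C (ρ i')).pow (m i')), add_comm]
  simp only [natDegree_linPow]
  exact add_sum_erase s m hi

/-- `deg pfTerm_i ≤ Σ m − 1` (when `m i ≥ 1`). -/
theorem natDegree_pfTerm_le (hm : ∀ i ∈ s, 1 ≤ m i) {i : ι} (hi : i ∈ s) (N : ℚ[X]) :
    (pfTerm s ρ m N i).natDegree ≤ (∑ i' ∈ s, m i') - 1 := by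
  have h := natDegree_Dhat_add (ρ := ρ) (m := m) hi
  have h1 := hm i hi
  unfold pfTerm
  refine (natDegree_add_le _ _).trans (max_le ?_ ?_)
  · exact (natDegree_C_mul_le _ _).trans (by omega)
  · refine (natDegree_C_mul_le _ _).trans (natDegree_mul_le.trans ?_)
    rw [natDegree_linPow]
    omega

/-- `deg P < deg D` as soon as `deg N < deg D`. -/
theorem natDegree_pfRem_lt (hm : ∀ i ∈ s, 1 ≤ m i) (N : ℚ[X]) (hN : N.natDegree < ∑ i ∈ s, m i) :
    (pfRem s ρ m N).natDegree < (Dp s ρ m).natDegree := by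
  rw [natDegree_Dp]
  unfold pfRem
  refine lt_of_le_of_lt (natDegree_sub_le _ _) (max_lt hN ?_)
  exact lt_of_le_of_lt (natDegree_sum_le_of_forall_le s _ fun i hi => natDegree_pfTerm_le hm hi N) (by omega)

/-! ### Divisibility: `P` vanishes to order `m i` at every pole -/

/-- a root of `p` and of `p′` is a double root. -/
theorem sq_dvd_of_isRoot {p : ℚ[X]} {a : ℚ} (h0 : p.IsRoot a) (h1 : (derivative p).IsRoot a) :
    (X - C a) ^ 2 ∣ p := by
  by_cases hp : p = 0
  · rw [hp]; exact dvd_zero _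
  · exact (pow_dvd_pow _ ((one_lt_rootMultiplicity_iff_isRoot hp).mpr ⟨h0, h1⟩)).trans
      (pow_rootMultiplicity_dvd p a)

/-- the other groups keep the full factor `(X − ρ j)^{m j}`. -/
theorem linPow_dvd_pfTerm_of_ne {i j : ι} (hj : j ∈ s) (hij : j ≠ i) (N : ℚ[X]) :
    (X - C (ρ j)) ^ m j ∣ pfTerm s ρ m N i := by
  have hd : (X - C (ρ j)) ^ m j ∣ Dhat s ρ m i :=
    dvd_prod_of_mem (fun i' => (X - C (ρ i')) ^ m i') (mem_erase.mpr ⟨hij, hj⟩)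
  exact dvd_add (hd.mul_left _) ((hd.mul_left _).mul_left _)

/-- the own group: `(X − ρ j)^{m j} ∣ N − pfTerm_j` — the value (and, at a double pole, the derivative) of
`N − pfTerm_j` at `ρ j` vanish by the choice of `cTop` and `cNext`. -/
theorem linPow_dvd_sub_pfTerm (hρ : Function.Injective ρ) (hm : ∀ i ∈ s, m i = 1 ∨ m i = 2) {j : ι}
    (hj : j ∈ s) (N : ℚ[X]) : (X - C (ρ j)) ^ m j ∣ N - pfTerm s ρ m N j := by
  have hD := eval_Dhat_self_ne (s := s) (m := m) hρ j
  rcases hm j hj with h | h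
  · -- simple pole: one vanishing
    have hl : cLow s ρ m N j = 0 := by simp [cLow, h]
    rw [h, pow_one]
    refine dvd_iff_isRoot.mpr ?_
    simp only [IsRoot.def, pfTerm, hl, map_zero, zero_mul, add_zero, eval_sub, eval_mul, eval_C, cTop,
      div_mul_cancel₀ _ hD, sub_self]
  · -- double pole: value and derivative vanish
    have hl : cLow s ρ m N j = cNext s ρ m N j := by simp [cLow, h]
    rw [h]
    refine sq_dvd_of_isRoot ?_ ?_
    · simp only [IsRoot.def, pfTerm, h, eval_sub, eval_add, eval_mul, eval_C, eval_pow, eval_X, sub_self,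
        cTop, div_mul_cancel₀ _ hD]
      norm_num
    · simp only [IsRoot.def, pfTerm, hl, h, show (2 - 1 : ℕ) = 1 from rfl, pow_one, derivative_sub,
        derivative_add, derivative_mul, derivative_C, zero_mul, zero_add, derivative_X, sub_zero, one_mul,
        eval_sub, eval_add, eval_mul, eval_C, eval_X, sub_self, add_zero, cTop, cNext]
      field_simp
      ring_nf

/-- **`D ∣ P`**: the prime powers `(X − ρ j)^{m j}` are pairwise coprime and each divides `P`. -/
theorem Dp_dvd_pfRem (hρ : Function.Injective ρ) (hm : ∀ i ∈ s, m i = 1 ∨ m i = 2) (N : ℚ[X]) :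
    Dp s ρ m ∣ pfRem s ρ m N := by
  refine Finset.prod_dvd_of_coprime ?_ ?_
  · intro i _ j _ hij
    exact (isCoprime_X_sub_C_of_isUnit_sub (sub_ne_zero.mpr (hρ.ne hij)).isUnit).pow
  · intro j hj
    unfold pfRem
    rw [← add_sum_erase s _ hj, ← sub_sub]
    exact dvd_sub (linPow_dvd_sub_pfTerm hρ hm hj N)
      (dvd_sum fun i hi => linPow_dvd_pfTerm_of_ne hj (ne_of_mem_erase hi).symm N)

/-- **`P = 0`.** -/
theorem pfRem_eq_zero (hρ : Function.Injective ρ) (hm : ∀ i ∈ s, m i = 1 ∨ m i = 2) (N : ℚ[X])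
    (hN : N.natDegree < ∑ i ∈ s, m i) : pfRem s ρ m N = 0 :=
  eq_zero_of_dvd_of_natDegree_lt (Dp_dvd_pfRem hρ hm N)
    (natDegree_pfRem_lt (fun i hi => by rcases hm i hi with h | h <;> omega) N hN)

/-! ### The partial-fraction identity -/

/-- **Partial fractions with poles of order `≤ 2`, cover-up form.**  For distinct poles `ρ i`, multiplicities
`m i ∈ {1,2}`, `deg N < Σ m`, and `x` off the poles:
`N(x)/D(x) = Σ_i ( cTop_i/(x − ρ i)^{m i} + cLow_i/(x − ρ i) )`,
`cTop_i = N(ρ i)/D̂_i(ρ i)`, `cLow_i = (N/D̂_i)′(ρ i)` at a double pole and `0` at a simple one. -/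
theorem pf_eval (hρ : Function.Injective ρ) (hm : ∀ i ∈ s, m i = 1 ∨ m i = 2) (N : ℚ[X])
    (hN : N.natDegree < ∑ i ∈ s, m i) {x : ℚ} (hx : ∀ i ∈ s, x ≠ ρ i) :
    N.eval x / (Dp s ρ m).eval x =
      ∑ i ∈ s, (cTop s ρ m N i / (x - ρ i) ^ m i + cLow s ρ m N i / (x - ρ i)) := by
  have h0 := pfRem_eq_zero hρ hm N hN
  unfold pfRem at h0
  rw [sub_eq_zero] at h0
  have h0' : N.eval x = ∑ i ∈ s, (pfTerm s ρ m N i).eval x := by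
    conv_lhs => rw [h0]
    exact eval_finsetSum _ _ _
  rw [h0', sum_div]
  refine sum_congr rfl fun i hi => ?_
  have hxi : x - ρ i ≠ 0 := sub_ne_zero.mpr (hx i hi)
  have hDh : (Dhat s ρ m i).eval x ≠ 0 := eval_Dhat_ne fun i' hi' => hx i' (mem_of_mem_erase hi')
  have hm1 : (x - ρ i) ^ m i = (x - ρ i) ^ (m i - 1) * (x - ρ i) :=
    (pow_sub_one_mul (by rcases hm i hi with h | h <;> omega) _).symm
  have hp : (x - ρ i) ^ (m i - 1) ≠ 0 := pow_ne_zero _ hxi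
  rw [Dp_eq_mul_Dhat hi, eval_mul, eval_linPow]
  simp only [pfTerm, eval_add, eval_mul, eval_C, eval_linPow]
  rw [hm1]
  field_simp

/-- the same with the simple/double case split displayed. -/
theorem pf_eval' (hρ : Function.Injective ρ) (hm : ∀ i ∈ s, m i = 1 ∨ m i = 2) (N : ℚ[X])
    (hN : N.natDegree < ∑ i ∈ s, m i) {x : ℚ} (hx : ∀ i ∈ s, x ≠ ρ i) :
    N.eval x / (Dp s ρ m).eval x =
      ∑ i ∈ s, (cTop s ρ m N i / (x - ρ i) ^ m i
        + if m i = 2 then cNext s ρ m N i / (x - ρ i) else 0) := by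
  rw [pf_eval hρ hm N hN hx]
  refine sum_congr rfl fun i _ => ?_
  unfold cLow
  split_ifs <;> simp

/-! ### Logarithmic derivative of a product of linear factors -/

/-- `(∏_k (X − γ k))′(x) = (∏_k (X − γ k))(x) · Σ_k (x − γ k)⁻¹` for `x` off the roots. -/
theorem eval_derivative_prod_linear {κ : Type*} [DecidableEq κ] (t : Finset κ) (γ : κ → ℚ) {x : ℚ}
    (hx : ∀ k ∈ t, x ≠ γ k) :
    (derivative (∏ k ∈ t, (X - C (γ k)))).eval x
      = (∏ k ∈ t, (X - C (γ k))).eval x * ∑ k ∈ t, (x - γ k)⁻¹ := by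
  rw [derivative_prod_finset, eval_finsetSum, eval_prod, mul_sum]
  refine sum_congr rfl fun k hk => ?_
  have hk0 : x - γ k ≠ 0 := sub_ne_zero.mpr (hx k hk)
  rw [eval_mul, derivative_X_sub_C, eval_one, mul_one, eval_prod]
  simp only [eval_sub, eval_X, eval_C]
  rw [← mul_prod_erase t (fun k => x - γ k) hk]
  field_simp

/-- product form of the same: `(F·G)′(x)/(F·G)(x) = F′(x)/F(x) + G′(x)/G(x)` needs no lemma beyond
`derivative_mul`; recorded here for products of linear factors: if `F(x), G(x) ≠ 0` then
`(FG)′(x) = (FG)(x) · (F′(x)/F(x) + G′(x)/G(x))`. -/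
theorem eval_derivative_mul_eq (F G : ℚ[X]) {x : ℚ} (hF : F.eval x ≠ 0) (hG : G.eval x ≠ 0) :
    (derivative (F * G)).eval x
      = (F * G).eval x * ((derivative F).eval x / F.eval x + (derivative G).eval x / G.eval x) := by
  rw [derivative_mul, eval_add, eval_mul, eval_mul, eval_mul]
  field_simp

end Summit.KontsevichZagierPeriods.Zeta5Search.Denom.PartialFractions
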